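import Mathlib
import Summits.CriticalPhenomena.CardyFormulaZ2.Theorems.CardyMagicRigidityDefs
import Summits.CriticalPhenomena.CardyFormulaZ2.Theorems.CardyMagicRigidityPositiveConeDefs
import Summits.CriticalPhenomena.CardyFormulaZ2.Theorems.CardyMagicRigidityNestingRigidityPrecompactnessLimitSamples
import Literature.Probability.Percolation.SiteLoopDensity
import Literature.Probability.RandomPlanarGeometry.LocFinLoopConfig
import HarnessLib

/-!
# Stub `stub_precompactness`, regular limits: the dust property of limit presentations from mesoscopic loop density

Crux `Summit.CriticalPhenomena.CardyFormulaZ2.Theses.CardyMagicRigidity.NestingRigidity`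
(stmt-CriticalPhenomena-4835), line `positive-cone-weight-doubling`, registered stub `stub_precompactness :
PrecompactRegular zEns ∧ PrecompactRegular tEns`.  The assembly `regularModification_of_ae_boundary_separating`
(`…PrecompactnessRegularAssembly`, p129759) reduces the regular modification (T2m) of a `d_CN`-limit presentation
`X` of a lattice ensemble to three a.s. properties: (B) boundary and (S) separating for the non-point loops, and
(D) DUST — every point loop of `X s` is a `udist`-limit of non-point loops of `X s` of its type.  This file
transfers (D) to a pure LATTICE statement, taken as an explicit hypothesis (no new definition): MESOSCOPIC LOOP
DENSITY — for every window `R`, radius `r > 0` and `κ > 0` there is a diameter `d > 0` such that for all small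
meshes, outside a measurable event of probability `≤ κ`, every point `z` of `B̄(0, R)` sees, for both types `i`, a
lattice loop of type `i` inside `B(z, r)` of diameter `≥ d` (RSW: an open circuit in `A(z; r/4, r/2)` inside a
closed circuit in `A(z; r/2, r)` confines a primal cluster whose exterior boundary is such a loop — independent
annuli, union bound over a net; NOT proved here):

* `Precompact.ae_mesoscopic_of_tendsto_cnLawEDist` — under that hypothesis, for `ν`-a.e. `s`: every point `z` and
  radius `r > 0` admit, for both types, a NON-POINT loop of `X s` inside `B(z, r)` (off the exceptional event of a
  coupling at scale `ε ≪ d`, the lattice loop inside `B(z, r − ε)` of diameter `≥ d` has a partner in `X s` inside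
  `B(z, r)` of diameter `≥ d − 2ε > 0`; the co-projection bound `Precompact.exists_measurableSet_superset_forall_
  section` returns to `s`; `κ, ε → 0`; rational windows and radii);
* `ae_dust_of_tendsto_cnLawEDist` (registered anchor) — hence hypothesis (D) of the assembly: a point loop at `z`
  and a loop inside `B̄(z, ε/2)` are at `udist ≤ ε` (`UnbasedLoop.udist_le_of_subset_closedBall`).
-/

noncomputable section

open MeasureTheory Set Filter Metric
open scoped Real Topology BigOperators ENNReal

namespace Summit.CriticalPhenomena.CardyFormulaZ2.Cruxes.NestingRigidity.PositiveConeWeightDoubling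

open Literature.Probability.RandomPlanarGeometry Literature.Probability.Percolation
  Literature.Probability.LatticeModels
open Summit.CriticalPhenomena.CardyFormulaZ2.Theses.CardyMagicRigidity
open Summit.CriticalPhenomena.CardyFormulaZ2.Cruxes.NestingRigidity.RingCloudTomography

namespace Precompact

section Dust

variable {E : LoopEnsemble} {Ω' : Type*} [MeasurableSpace Ω']

/-- **Key bound for the dust property.**  With the mesoscopic-density hypothesis at `(R, r, κ)` giving the diameter
`d`, the set of `s` for which some `z ∈ B̄(0, R)` and some type `i` have NO loop of `X s` of type `i` inside
`B(z, r)` of diameter `≥ d/2` has `ν`-measure `≤ 2κ`. -/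
theorem measure_noMesoscopic_le (hE : E ∈ latticeEnsembles) {δs : ℕ → ℝ} (hδs : Tendsto δs atTop (𝓝[>] (0 : ℝ)))
    (ν : Measure Ω') [IsFiniteMeasure ν] {X : Ω' → LoopConfig ℂ}
    (hm : ∀ (k : ℕ) (ε : ℝ), MeasurableSet {p : E.Ω × Ω' | LoopConfig.IsClose ε (E.X (δs k) p.1) (X p.2)})
    (h : Tendsto (fun k : ℕ ↦ LoopConfig.cnLawEDist E.P (E.X (δs k)) ν X) atTop (𝓝 0))
    {R r κ d : ℝ} (hR : 0 ≤ R) (hr : 0 < r) (hd : 0 < d)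
    (hdens : ∀ᶠ δ in 𝓝[>] (0 : ℝ), ∃ Fev : Set E.Ω, MeasurableSet Fev ∧ E.P Fev ≤ ENNReal.ofReal κ ∧
      ∀ ω ∉ Fev, ∀ z ∈ closedBall (0 : ℂ) R, ∀ i : Fin 2, ∀ r' : ℝ, r / 2 ≤ r' →
        ∃ v ∈ (E.X δ ω).F i, v.range ⊆ ball z r' ∧ d ≤ diam v.range) :
    ν {s | ∃ z ∈ closedBall (0 : ℂ) R, ∃ i : Fin 2, ∀ v ∈ (X s).F i, v.range ⊆ ball z r → diam v.range < d / 2} ≤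
      2 * ENNReal.ofReal κ := by
  obtain ⟨hSB, hne⟩ := standardBorelSpace_nonempty_of_mem hE
  haveI := hSB; haveI := hne
  set S := {s | ∃ z ∈ closedBall (0 : ℂ) R, ∃ i : Fin 2, ∀ v ∈ (X s).F i,
    v.range ⊆ ball z r → diam v.range < d / 2} with hSdef
  -- up to `2ε` for every small `ε`
  suffices key : ∀ ε : ℝ, 0 < ε → ε ≤ d / 4 → ε ≤ r / 2 → ε ≤ 1 / (R + r + 1) →
      ν S ≤ 2 * ENNReal.ofReal ε + 2 * ENNReal.ofReal κ by
    refine ENNReal.le_of_forall_pos_le_add fun θ hθ _ ↦ ?_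
    set ε : ℝ := min (min (d / 4) (r / 2)) (min (1 / (R + r + 1)) (θ / 2)) with hεdef
    have hθ' : (0 : ℝ) < θ := hθ
    have hε0 : 0 < ε := by positivity
    have hb := key ε hε0 ((min_le_left _ _).trans (min_le_left _ _)) ((min_le_left _ _).trans (min_le_right _ _))
      ((min_le_right _ _).trans (min_le_left _ _))
    have hεθ : 2 * ENNReal.ofReal ε ≤ (θ : ℝ≥0∞) := by
      have hε2 : ε ≤ θ / 2 := (min_le_right _ _).trans (min_le_right _ _)
      rw [show (2 : ℝ≥0∞) * ENNReal.ofReal ε = ENNReal.ofReal (2 * ε) by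
        rw [ENNReal.ofReal_mul (by norm_num), ENNReal.ofReal_ofNat], ← ENNReal.ofReal_coe_nnreal]
      exact ENNReal.ofReal_le_ofReal (by linarith)
    calc ν S ≤ 2 * ENNReal.ofReal ε + 2 * ENNReal.ofReal κ := hb
      _ ≤ θ + 2 * ENNReal.ofReal κ := add_le_add hεθ le_rfl
      _ = 2 * ENNReal.ofReal κ + θ := add_comm _ _
  intro ε hε hεd hεr hεR
  have hwin : R + r ≤ 1 / ε := by
    rw [le_one_div hε (by linarith : (0 : ℝ) < R + r + 1)] at hεR
    linarith
  -- a good index: density event available and `d_CN < ε`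
  have hev₁ : ∀ᶠ k in atTop, ∃ Fev : Set E.Ω, MeasurableSet Fev ∧ E.P Fev ≤ ENNReal.ofReal κ ∧
      ∀ ω ∉ Fev, ∀ z ∈ closedBall (0 : ℂ) R, ∀ i : Fin 2, ∀ r' : ℝ, r / 2 ≤ r' →
        ∃ v ∈ (E.X (δs k) ω).F i, v.range ⊆ ball z r' ∧ d ≤ diam v.range := hδs.eventually hdens
  have hev₂ : ∀ᶠ k in atTop, LoopConfig.cnLawEDist E.P (E.X (δs k)) ν X < ENNReal.ofReal ε :=
    h (Iio_mem_nhds (ENNReal.ofReal_pos.2 hε))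
  obtain ⟨k, ⟨Fev, hFm, hFle, hFdens⟩, hk⟩ := (hev₁.and hev₂).exists
  obtain ⟨P, hP₁, hP₂, hP₃⟩ := LoopConfig.exists_coupling_of_cnLawEDist_lt hk
  haveI : IsFiniteMeasure P := ⟨by
    rw [← Set.preimage_univ (f := (Prod.snd : E.Ω × Ω' → Ω')),
      ← Measure.map_apply measurable_snd MeasurableSet.univ, hP₂]
    exact measure_lt_top ν univ⟩
  set B : Set (E.Ω × Ω') := {p | ¬ LoopConfig.IsClose ε (E.X (δs k) p.1) (X p.2)} ∪ Prod.fst ⁻¹' Fev with hB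
  have hBm : MeasurableSet B := (hm k ε).compl.union (measurable_fst hFm)
  have hSB : S ⊆ {s | ∀ ω, (ω, s) ∈ B} := by
    intro s hs ω
    by_cases hcl : LoopConfig.IsClose ε (E.X (δs k) ω) (X s)
    · right
      by_contra hω
      obtain ⟨z, hz, i, hnone⟩ := hs
      -- a lattice loop inside `B(z, r - ε)` of diameter `≥ d`, and its partner in `X s`
      obtain ⟨v, hv, hvr, hvd⟩ := hFdens ω hω z hz i (r - ε) (by linarith)
      have hvwin : v.range ⊆ ball (0 : ℂ) (1 / ε) := by
        refine hvr.trans fun w hw ↦ ?_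
        rw [mem_ball, dist_zero_right]
        rw [mem_ball] at hw
        rw [mem_closedBall, dist_zero_right] at hz
        calc ‖w‖ = dist w 0 := (dist_zero_right w).symm
          _ ≤ dist w z + dist z 0 := dist_triangle _ _ _
          _ < (r - ε) + R := by rw [dist_zero_right]; linarith
          _ ≤ 1 / ε := by linarith
      obtain ⟨u, hu, hdu⟩ := (hcl i).1 v hv hvwin
      have hur : u.range ⊆ ball z r := by
        intro w hw
        obtain ⟨y, hy, hwy⟩ := UnbasedLoop.exists_mem_range_dist_le u v hw
        rw [UnbasedLoop.udist_comm] at hwy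
        have hy' := hvr hy
        rw [mem_ball] at hy' ⊢
        calc dist w z ≤ dist w y + dist y z := dist_triangle _ _ _
          _ < ε + (r - ε) := add_lt_add_of_le_of_lt (hwy.trans hdu) hy'
          _ = r := by ring
      have hud : d / 2 ≤ diam u.range := by
        have := UnbasedLoop.diam_range_le_of_udist_le v u hdu
        linarith
      exact (not_lt.2 hud) (hnone u hu hur)
    · exact Or.inl hcl
  obtain ⟨T, -, hTsub, hTle⟩ := exists_measurableSet_superset_forall_section P hBm
  rw [hP₂] at hTle
  have hPF : P (Prod.fst ⁻¹' Fev) = E.P Fev := by rw [← Measure.map_apply measurable_fst hFm, hP₁]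
  calc ν S ≤ ν T := measure_mono (hSB.trans hTsub)
    _ ≤ 2 * P B := hTle
    _ ≤ 2 * (ENNReal.ofReal ε + ENNReal.ofReal κ) := by
        gcongr 2 * ?_
        exact (measure_union_le _ _).trans (add_le_add hP₃.le (by rw [hPF]; exact hFle))
    _ = 2 * ENNReal.ofReal ε + 2 * ENNReal.ofReal κ := mul_add _ _ _

/-- **A.e. mesoscopic loops everywhere.**  Under the mesoscopic-density hypothesis (for all `R`, `r > 0`, `κ > 0`),
for `ν`-a.e. `s`: for both types `i`, every point `z` and every radius `r > 0` there is a NON-POINT loop of `X s` of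
type `i` with trace inside `B(z, r)`. -/
theorem ae_mesoscopic_of_tendsto_cnLawEDist (hE : E ∈ latticeEnsembles) {δs : ℕ → ℝ}
    (hδs : Tendsto δs atTop (𝓝[>] (0 : ℝ))) (ν : Measure Ω') [IsFiniteMeasure ν] {X : Ω' → LoopConfig ℂ}
    (hm : ∀ (k : ℕ) (ε : ℝ), MeasurableSet {p : E.Ω × Ω' | LoopConfig.IsClose ε (E.X (δs k) p.1) (X p.2)})
    (h : Tendsto (fun k : ℕ ↦ LoopConfig.cnLawEDist E.P (E.X (δs k)) ν X) atTop (𝓝 0))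
    (hdens : ∀ (R r κ : ℝ), 0 < r → 0 < κ → ∃ d : ℝ, 0 < d ∧ ∀ᶠ δ in 𝓝[>] (0 : ℝ),
      ∃ Fev : Set E.Ω, MeasurableSet Fev ∧ E.P Fev ≤ ENNReal.ofReal κ ∧
        ∀ ω ∉ Fev, ∀ z ∈ closedBall (0 : ℂ) R, ∀ i : Fin 2, ∀ r' : ℝ, r / 2 ≤ r' →
          ∃ v ∈ (E.X δ ω).F i, v.range ⊆ ball z r' ∧ d ≤ diam v.range) :
    ∀ᵐ s ∂ν, ∀ (i : Fin 2) (z : ℂ) (r : ℝ), 0 < r →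
      ∃ v ∈ (X s).F i, v.range.Nontrivial ∧ v.range ⊆ ball z r := by
  -- the bad sets at integer windows and radii `1/(n+1)` are null
  have hnull : ∀ (N n : ℕ), ν {s | ∃ z ∈ closedBall (0 : ℂ) N, ∃ i : Fin 2, ∀ v ∈ (X s).F i,
      v.range ⊆ ball z (1 / ((n : ℝ) + 1)) → ¬ v.range.Nontrivial} = 0 := by
    intro N n
    refine le_antisymm (ENNReal.le_of_forall_pos_le_add fun κ hκ _ ↦ ?_) bot_le
    rw [zero_add]
    have hκ' : (0 : ℝ) < κ := hκ
    obtain ⟨d, hd, hev⟩ := hdens N (1 / ((n : ℝ) + 1)) (κ / 2) (by positivity) (by positivity)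
    have hle := measure_noMesoscopic_le hE hδs ν hm h (Nat.cast_nonneg N) (by positivity) hd hev
    calc ν _ ≤ ν {s | ∃ z ∈ closedBall (0 : ℂ) N, ∃ i : Fin 2, ∀ v ∈ (X s).F i,
          v.range ⊆ ball z (1 / ((n : ℝ) + 1)) → diam v.range < d / 2} := by
          refine measure_mono fun s hs ↦ ?_
          obtain ⟨z, hz, i, hnone⟩ := hs
          refine ⟨z, hz, i, fun v hv hvr ↦ ?_⟩
          have h0 : diam v.range = 0 := diam_subsingleton fun a ha b hb ↦ by
            by_contra hab
            exact hnone v hv hvr ⟨a, ha, b, hb, hab⟩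
          rw [h0]; positivity
      _ ≤ 2 * ENNReal.ofReal (κ / 2) := hle
      _ = κ := by
          rw [← ENNReal.ofReal_ofNat, ← ENNReal.ofReal_mul (by norm_num), mul_div_cancel₀ _ two_ne_zero,
            ENNReal.ofReal_coe_nnreal]
  have hae : ∀ᵐ s ∂ν, ∀ (N n : ℕ), s ∉ {s | ∃ z ∈ closedBall (0 : ℂ) N, ∃ i : Fin 2, ∀ v ∈ (X s).F i,
      v.range ⊆ ball z (1 / ((n : ℝ) + 1)) → ¬ v.range.Nontrivial} :=
    ae_all_iff.2 fun N ↦ ae_all_iff.2 fun n ↦ measure_eq_zero_iff_ae_notMem.1 (hnull N n)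
  filter_upwards [hae] with s hs
  intro i z r hr
  obtain ⟨N, hN⟩ := exists_nat_ge ‖z‖
  obtain ⟨n, hn⟩ := exists_nat_one_div_lt hr
  have hs' : ¬ ∃ z ∈ closedBall (0 : ℂ) N, ∃ i : Fin 2, ∀ v ∈ (X s).F i,
      v.range ⊆ ball z (1 / ((n : ℝ) + 1)) → ¬ v.range.Nontrivial := hs N n
  push Not at hs'
  obtain ⟨v, hv, hvr, hvnt⟩ := hs' z (by rwa [mem_closedBall, dist_zero_right]) i
  exact ⟨v, hv, hvnt, hvr.trans (ball_subset_ball hn.le)⟩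

end Dust

end Precompact

open Precompact in
/-- **The dust property (D) of limit presentations from mesoscopic loop density (registered anchor).**  Let
`E ∈ latticeEnsembles`, `δₖ → 0⁺`, `X` a presentation (finite measure space, measurable exceptional events) of a
sequential `d_CN`-limit of the laws of `E.X δₖ`, and assume MESOSCOPIC LOOP DENSITY of the lattice ensemble: for all
`R`, `r > 0`, `κ > 0` there is `d > 0` such that for all small meshes, off a measurable event of probability `≤ κ`,
every `z ∈ B̄(0, R)` has, for both types and every `r' ≥ r/2`, a lattice loop of that type inside `B(z, r')` of
diameter `≥ d`.  Then for `ν`-a.e. `s`, every POINT loop of `X s` is, at every scale `ε > 0`, within `udist ≤ ε`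
of a NON-POINT loop of `X s` of its type — hypothesis (D) of `regularModification_of_ae_boundary_separating`. -/
theorem ae_dust_of_tendsto_cnLawEDist : ∀ E ∈ latticeEnsembles, ∀ (δs : ℕ → ℝ)
    {Ω' : Type} [MeasurableSpace Ω'] (ν : Measure Ω') [IsFiniteMeasure ν] (X : Ω' → LoopConfig ℂ),
    Tendsto δs atTop (𝓝[>] (0 : ℝ)) →
    (∀ (k : ℕ) (ε : ℝ), MeasurableSet {p : E.Ω × Ω' | LoopConfig.IsClose ε (E.X (δs k) p.1) (X p.2)}) →
    Tendsto (fun k : ℕ ↦ LoopConfig.cnLawEDist E.P (E.X (δs k)) ν X) atTop (𝓝 0) →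
    (∀ (R r κ : ℝ), 0 < r → 0 < κ → ∃ d : ℝ, 0 < d ∧ ∀ᶠ δ in 𝓝[>] (0 : ℝ),
      ∃ Fev : Set E.Ω, MeasurableSet Fev ∧ E.P Fev ≤ ENNReal.ofReal κ ∧
        ∀ ω ∉ Fev, ∀ z ∈ closedBall (0 : ℂ) R, ∀ i : Fin 2, ∀ r' : ℝ, r / 2 ≤ r' →
          ∃ v ∈ (E.X δ ω).F i, v.range ⊆ ball z r' ∧ d ≤ diam v.range) →
    ∀ᵐ s ∂ν, ∀ (i : Fin 2), ∀ u ∈ (X s).F i, ¬ u.range.Nontrivial → ∀ ε : ℝ, 0 < ε →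
      ∃ v ∈ (X s).F i, v.range.Nontrivial ∧ u.udist v ≤ ε := by
  intro E hE δs Ω' _ ν _ X hδs hm h hdens
  filter_upwards [ae_mesoscopic_of_tendsto_cnLawEDist hE hδs ν hm h hdens] with s hs
  intro i u _ hu ε hε
  obtain ⟨z, hz⟩ := u.range_nonempty
  have hsub : u.range ⊆ closedBall z (ε / 2) := fun w hw ↦ by
    have : w = z := by
      by_contra hwz
      exact hu ⟨w, hw, z, hz, hwz⟩
    rw [this]
    exact mem_closedBall_self (by positivity)
  obtain ⟨v, hv, hvnt, hvr⟩ := hs i z (ε / 2) (by positivity)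
  refine ⟨v, hv, hvnt, ?_⟩
  calc u.udist v ≤ 2 * (ε / 2) :=
        UnbasedLoop.udist_le_of_subset_closedBall (by positivity) hsub (hvr.trans ball_subset_closedBall)
    _ = ε := by ring

end Summit.CriticalPhenomena.CardyFormulaZ2.Cruxes.NestingRigidity.PositiveConeWeightDoubling

end
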